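import Literature.AlgebraicGeometry.Resolution.InseparableLocalUniformizationEngineTower
import Literature.AlgebraicGeometry.Resolution.InseparableLocalUniformizationStepsThreeFourWeak
import Literature.AlgebraicGeometry.Resolution.InseparableLocalUniformizationSimplePoint
import HarnessLib

/-!
# Steps 3–4 of the proof of Temkin's Thm. 4.1.1: the corrected fact `Temkin2013_Steps34_tower` PROVED

Topic: `Literature/AlgebraicGeometry/Resolution`. M. Temkin, *Inseparable local uniformization*,
J. Algebra 373 (2013) 65–119 = arXiv:0804.1554v3, proof of Thm. 4.1.1, Steps 3–4 (pp. 48–49;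
p. 30 of the 41-pp. arXiv version held in the literature store) and §4.2, Step 2 (p. 51).

The named fact `Temkin2013_Steps34_tower` (`InseparableLocalUniformizationEngineTower.lean`,
the corrected rendering of `Temkin2013_Steps34` in which `k̄` acts on `K₁` through `K`) is
DISCHARGED here:

* `Temkin2013_Steps34_tower_holds : Temkin2013_Steps34_tower` — PROVED, by composing two
  theorems of the tree: `descentConclusionWeak_of_steps34Data`
  (`InseparableLocalUniformizationStepsThreeFourWeak.lean`: from the verbatim binders of the
  fact, Step 3 — Lemma 2.8.4 `Temkin2013_Lemma284_holds`, openness of `S₁` in `Nr_m(S)`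
  `Temkin2013_valuationRingOpen_holds` —, the hypothesis "Thm. 4.1.1 applies to `Y`"
  (`Temkin2013DescentFor k k̄ k̄°`), Step 4 — Lemma 2.8.5 `Temkin2013_Lemma285_normal_holds`,
  descent of smoothness along smooth covers `SmoothDescentField.lean` / `SmoothDescent.lean` —
  give the WEAK conclusion: the centre of `L₁°` on `Nr_{L₁}(X′)` is `l`-smooth) and
  `Temkin2013DescentConclusion.of_weak` (`InseparableLocalUniformizationSimplePoint.lean`: the
  final enlargement of `l`, "replacing `l` with a purely inseparable extension, we can also
  arrange that `x₁` is a simple `l`-smooth point", plus regularity of smooth points).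

Consequently every theorem of the tree stated with `(h : Temkin2013_Steps34_tower)`
(`…DefectStepTower.lean`, `…HeightStepTwoTower.lean`, `…HeightInductionTower.lean`) becomes
unconditional in this hypothesis by feeding `Temkin2013_Steps34_tower_holds`.

## Sources

* M. Temkin, *Inseparable local uniformization*, arXiv:0804.1554v3: proof of Thm. 4.1.1, Steps
  3–4 (pp. 48–49); §4.2, Step 2 (p. 51).
-/

noncomputable section

namespace Literature.AlgebraicGeometry.Resolution

universe u

/-- **Steps 3–4 of the proof of Temkin's Thm. 4.1.1 (corrected rendering) — PROVED**: the
named fact `Temkin2013_Steps34_tower` holds. Proof: the weak conclusion from Steps 3–4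
(`descentConclusionWeak_of_steps34Data`) followed by the final enlargement of `l`
(`Temkin2013DescentConclusion.of_weak`).
[cite: Temkin2013, proof of Thm. 4.1.1, Steps 3–4 (arXiv:0804.1554v3 pp. 48–49) and Section 4.2, Step 2 (p. 51)] -/
theorem Temkin2013_Steps34_tower_holds : Temkin2013_Steps34_tower.{u} := by
  intro k K _ _ _ hfg O hk kb hkbfg hdim hDY B hBO hBfg hBfr A hAO hAfg hAfr hAn hBA K₁ _ _ hfin
    O₁ hO₁ m _ _ hmfin Om hOm hXS hOm' hSE
  exact Temkin2013DescentConclusion.of_weak O A K₁ O₁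
    (descentConclusionWeak_of_steps34Data k K hfg O hk kb hkbfg hdim hDY B hBO hBfg hBfr A hAO
      hAfg hAfr hAn hBA K₁ hfin O₁ hO₁ m hmfin Om hOm hXS hOm' hSE)

end Literature.AlgebraicGeometry.Resolution
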